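import Mathlib
import Summits.Ventures.HodgeRepro2.Tier7.Line3.TorusSupport
import Summits.Ventures.HodgeRepro2.Tier7.Line3.TorusCompact
import Summits.Ventures.HodgeRepro2.Tier7.Line3.ConcreteLevelFactor

/-!
# Tier7/Line3/CharacterLocallyConstant — the characters at `v₁` are locally constant and unitary because they are continuous
(seat t7-L1-p4, gen 5; the four displayed hypotheses `hχA`, `hψB` (unitarity) and `hχA'`, `hψB'` (local constancy) of
LevelFactorPositive p691647 / LevelFactorOfLocal p693983 / ConcreteLevelFactor p698828 for the concrete tori of
TorusSupport p695064 / TorusCompact p697465)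

LINE 3 (t7-plan-3), version (ii). The level-place chain (x1 g3) takes the local characters `χ_A : T_A(F_{v₁}) → ℂ`,
`ψ_B : T_B(F_{v₁}) → ℂ` as DISPLAYED data: unitary (`‖χ_A a‖ = 1`) and locally constant (`IsLocallyConstant`); the
[W] column of the residual map (crit-2 l. 15711 (c)) keeps «local constancy of μ_{A,v₁}, μ_{B,v₁}⁻¹» in words. Both
clauses are THEOREMS of the one fact that defines a character of a topological group — CONTINUITY — once the tori are
known to be compact and totally disconnected, which they are over an ultrametric local field:

* §1 `ℂ` HAS NO SMALL SUBGROUPS — BY SQUARING (the proof of p1 g44, STATUS l. 15796 / l. 15810, adopted on plan-3's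
  ruling l. 15806 (i); the four lemmas are p1's, verbatim): on the ball `‖z − 1‖ < 1/2` one has `‖z + 1‖ ≥ 3/2`, so
  `‖z² − 1‖ = ‖z − 1‖·‖z + 1‖ ≥ (3/2)‖z − 1‖` (`norm_sq_sub_one_ge`); iterating, `‖z^(2^k) − 1‖ ≥ (3/2)^k ‖z − 1‖`
  while the iterates stay in the ball (`norm_pow_two_pow_sub_one_ge`), which leaves the ball unless `z = 1`
  (`pow_unbounded_of_one_lt`): a set closed under squaring inside that ball is `⊆ {1}` (`eq_one_of_sq_mem_of_subset_ball`),
  and a monoid hom `χ : G →* ℂ` is `1` on a squaring-closed set where `‖χ − 1‖ < 1/2` (`eq_one_of_forall_norm_sub_one_lt`).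
  No `arg`, no `cos`, no unitarity. This seat's own first proof (`z = exp(arg z · I)`, the power `m` with
  `m · arg z ∈ [π/2, 3π/2]`) is superseded and kept only in the read copy's history.
* §2 UNITARITY. `norm_apply_eq_one_of_compact`: a continuous `χ : A →* ℂ` on a compact group has compact, hence bounded,
  image, and `‖χ a‖ ^ n = ‖χ (a ^ n)‖` bounded for all `n : ℤ` forces `‖χ a‖ = 1` (`norm_eq_one_of_forall_zpow_norm_lt`:
  `‖z‖ > 1` or `‖z⁻¹‖ > 1` gives unbounded powers). Not needed for §3; it is the unitarity clause on its own.
* §3 LOCAL CONSTANCY. `exists_openNormalSubgroup_eq_one`: on a compact totally disconnected group Mathlib's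
  `ProfiniteGrp.exist_openNormalSubgroup_sub_open_nhds_of_one` puts an open normal subgroup `H` inside the open
  neighbourhood `χ⁻¹(ball 1 (1/2))` of `1`; `H` is closed under squaring, so `χ = 1` on `H` by §1. Hence
  `isLocallyConstant_of_continuous`: `χ` is constant on the open cosets `x · H`.
* §4 TOTAL DISCONNECTEDNESS OF THE MODEL'S GROUPS. Over an ultrametric normed field `F` (Mathlib: `IsUltrametricDist`
  ⇒ `TotallySeparatedSpace` ⇒ `TotallyDisconnectedSpace`), the units `Fˣ` are totally disconnected (they embed into
  `F × Fᵐᵒᵖ`, `Units.isEmbedding_embedProduct`), hence so are `Fin 2 → Fˣ`, `GL (Fin 2) F = (Matrix (Fin 2) (Fin 2) F)ˣ`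
  and every subgroup (subtype) — stated as THEOREMS, no instance is declared.
* §5 THE CONSUMER on the concrete model: for `torusA σ` and `torusB σ f` with `[ProperSpace F] [IsUltrametricDist F]`,
  `hσc`, `hσn`, `hP` (TorusCompact's compactness), every CONTINUOUS `χA : torusA σ →* ℂ`, `ψB : torusB σ f →* ℂ` is
  unitary and locally constant (`norm_apply_eq_one_torusA/B`, `isLocallyConstant_torusA/B`), and
  `concrete_kappaData_b_fields_of_continuous` = ConcreteLevelFactor's `concrete_kappaData_b_fields` with the four
  displayed hypotheses `hχA hψB hχA' hψB'` REPLACED by `Continuous χA`, `Continuous ψB`.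

WHAT CHANGES IN THE [W] COLUMN: «χ_A / ψ_B unitary and locally constant (the characters of a `p`-adic torus are)» becomes
«χ_A / ψ_B continuous» — the definition of a character of a topological group; nothing else is displayed. At
`F := w.adicCompletion E` (x1's AdicCompletionLocalField) the same theorems apply verbatim (`ProperSpace` and
`IsUltrametricDist` are instances there). DICTIONARY (in words, unchanged): `F = E_{v₁}`, `σ` the involution of
`E_{v₁}/F_{v₁}`, `χ_A = μ_{A,v₁}`, `ψ_B = μ_{B,v₁}⁻¹` the local components of the Hecke characters of the datum.
Nothing here is about (N), (P), the real `X`, or HC_CM; §8(d): NO (no non-vanishing device of any kind).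
Blind lane: Mathlib + the HodgeRepro2 prefix; no sorry; axioms ⊆ {propext, Classical.choice, Quot.sound}.
-/

namespace Summit.Ventures.HodgeRepro2.Tier7.Line3.CharacterLocallyConstant

open Complex Topology

/-! ## §1 `ℂ` has no small subgroups: squaring escapes the ball of radius `1/2` about `1`
(p1 g44's proof, STATUS l. 15796 / l. 15810; adopted on plan-3's ruling l. 15806 (i)) -/

/-- on the ball `‖z − 1‖ < 1/2`: `‖z² − 1‖ ≥ (3/2) ‖z − 1‖` (p1 g44). -/
theorem norm_sq_sub_one_ge {z : ℂ} (hz : ‖z - 1‖ < 1 / 2) : 3 / 2 * ‖z - 1‖ ≤ ‖z ^ 2 - 1‖ := by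
  have hfac : z ^ 2 - 1 = (z - 1) * (z + 1) := by ring
  have h2 : (3 : ℝ) / 2 ≤ ‖z + 1‖ := by
    have h := norm_sub_norm_le (2 : ℂ) (1 - z)
    have he : (2 : ℂ) - (1 - z) = z + 1 := by ring
    rw [he, Complex.norm_two, norm_sub_rev] at h
    linarith
  rw [hfac, norm_mul, mul_comm]
  exact mul_le_mul_of_nonneg_left h2 (norm_nonneg _)

/-- iterated squaring: while `z, z², …, z^(2^(k-1))` stay in the ball, `‖z^(2^k) − 1‖ ≥ (3/2)^k ‖z − 1‖` (p1 g44). -/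
theorem norm_pow_two_pow_sub_one_ge (z : ℂ) (k : ℕ) (h : ∀ j < k, ‖z ^ (2 ^ j) - 1‖ < 1 / 2) :
    (3 / 2) ^ k * ‖z - 1‖ ≤ ‖z ^ (2 ^ k) - 1‖ := by
  induction k with
  | zero => simp
  | succ k ih =>
    have h1 := ih fun j hj => h j (Nat.lt_succ_of_lt hj)
    have h3 := norm_sq_sub_one_ge (h k (Nat.lt_succ_self k))
    rw [← pow_mul, ← pow_succ] at h3
    calc (3 / 2) ^ (k + 1) * ‖z - 1‖ = 3 / 2 * ((3 / 2) ^ k * ‖z - 1‖) := by ring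
      _ ≤ 3 / 2 * ‖z ^ (2 ^ k) - 1‖ := by gcongr
      _ ≤ ‖z ^ (2 ^ (k + 1)) - 1‖ := h3

/-- **no small subgroups in `ℂ`**: a set closed under squaring and contained in the open ball of radius `1/2` about `1`
consists of `1` alone (p1 g44). -/
theorem eq_one_of_sq_mem_of_subset_ball {S : Set ℂ} (hS : ∀ z ∈ S, z ^ 2 ∈ S)
    (hball : ∀ z ∈ S, ‖z - 1‖ < 1 / 2) {z : ℂ} (hz : z ∈ S) : z = 1 := by
  by_contra hne
  have hδ : 0 < ‖z - 1‖ := norm_pos_iff.mpr (sub_ne_zero.mpr hne)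
  have hmem : ∀ k, z ^ (2 ^ k) ∈ S := by
    intro k
    induction k with
    | zero => simpa using hz
    | succ k ih => rw [pow_succ, pow_mul]; exact hS _ ih
  obtain ⟨k, hk⟩ := pow_unbounded_of_one_lt (1 / (2 * ‖z - 1‖)) (by norm_num : (1 : ℝ) < 3 / 2)
  have h1 := norm_pow_two_pow_sub_one_ge z k fun j _ => hball _ (hmem j)
  have h2 := hball _ (hmem k)
  rw [div_lt_iff₀ (by positivity)] at hk
  have h4 : (3 / 2 : ℝ) ^ k * (2 * ‖z - 1‖) = 2 * ((3 / 2) ^ k * ‖z - 1‖) := by ring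
  linarith

/-- a monoid hom into `ℂ` whose values on a squaring-closed set `H` lie in the ball of radius `1/2` about `1` is `1`
on `H` (p1 g44). -/
theorem eq_one_of_forall_norm_sub_one_lt {G : Type*} [Monoid G] (χ : G →* ℂ) {H : Set G}
    (hH : ∀ g ∈ H, g ^ 2 ∈ H) (hball : ∀ g ∈ H, ‖χ g - 1‖ < 1 / 2) {g : G} (hg : g ∈ H) : χ g = 1 :=
  eq_one_of_sq_mem_of_subset_ball (S := χ '' H)
    (fun _ ⟨g, hg, hz⟩ => ⟨g ^ 2, hH g hg, by rw [map_pow, hz]⟩)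
    (fun _ ⟨g, hg, hz⟩ => hz ▸ hball g hg) ⟨g, hg, rfl⟩

/-- bounded integer powers force `‖z‖ = 1` (for `z ≠ 0`): `‖z‖ > 1` or `‖z⁻¹‖ > 1` would give unbounded powers. -/
theorem norm_eq_one_of_forall_zpow_norm_lt (z : ℂ) (hz : z ≠ 0) (C : ℝ) (h : ∀ n : ℤ, ‖z ^ n‖ < C) :
    ‖z‖ = 1 := by
  have hpos : 0 < ‖z‖ := norm_pos_iff.2 hz
  rcases lt_trichotomy ‖z‖ 1 with hlt | heq | hgt
  · exfalso
    have h1 : 1 < ‖z‖⁻¹ := one_lt_inv_iff₀.2 ⟨hpos, hlt⟩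
    obtain ⟨n, hn⟩ := pow_unbounded_of_one_lt C h1
    have hh := h (-(n : ℤ))
    rw [zpow_neg, zpow_natCast, norm_inv, norm_pow, ← inv_pow] at hh
    linarith
  · exact heq
  · exfalso
    obtain ⟨n, hn⟩ := pow_unbounded_of_one_lt C hgt
    have hh := h n
    rw [zpow_natCast, norm_pow] at hh
    linarith

/-! ## §2 Continuous characters of compact groups are unitary -/

/-- a character of a group never vanishes. -/
theorem apply_ne_zero {A : Type*} [Group A] (χ : A →* ℂ) (a : A) : χ a ≠ 0 := by
  intro h0
  have h := χ.map_mul a a⁻¹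
  rw [mul_inv_cancel, map_one, h0, zero_mul] at h
  exact one_ne_zero h

section Characters

variable {A : Type*} [Group A] [TopologicalSpace A]

/-- **unitarity**: a continuous character of a compact group takes values on the unit circle (the image is
compact, hence bounded, and the powers `‖χ a‖ ^ n = ‖χ (a ^ n)‖`, `n : ℤ`, are bounded). -/
theorem norm_apply_eq_one_of_compact [CompactSpace A] (χ : A →* ℂ) (hχ : Continuous χ) (a : A) :
    ‖χ a‖ = 1 := by
  have hcompact : IsCompact (Set.range χ) := isCompact_range hχ
  obtain ⟨C, hC⟩ := hcompact.isBounded.exists_norm_le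
  refine norm_eq_one_of_forall_zpow_norm_lt (χ a) (apply_ne_zero χ a) (C + 1) fun n => ?_
  rw [← map_zpow]
  have h := hC (χ (a ^ n)) ⟨a ^ n, rfl⟩
  linarith

/-! ## §3 Continuous characters of compact totally disconnected groups are locally constant -/

/-- a continuous character of a compact totally disconnected group is trivial on an open normal subgroup
(Mathlib's open normal subgroup inside `χ⁻¹(ball 1 (1/2))`, a squaring-closed set, then §1). -/
theorem exists_openNormalSubgroup_eq_one [IsTopologicalGroup A] [CompactSpace A]
    [TotallyDisconnectedSpace A] (χ : A →* ℂ) (hχ : Continuous χ) :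
    ∃ H : OpenNormalSubgroup A, ∀ a ∈ H, χ a = 1 := by
  have hU : IsOpen (χ ⁻¹' Metric.ball (1 : ℂ) (1 / 2)) := Metric.isOpen_ball.preimage hχ
  have h1 : (1 : A) ∈ χ ⁻¹' Metric.ball (1 : ℂ) (1 / 2) := by
    simp [Metric.mem_ball]
  obtain ⟨H, hH⟩ := ProfiniteGrp.exist_openNormalSubgroup_sub_open_nhds_of_one hU h1
  refine ⟨H, fun a ha => ?_⟩
  refine eq_one_of_forall_norm_sub_one_lt χ (H := (H : Set A)) (fun g hg => pow_mem hg 2) ?_ ha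
  intro g hg
  have hball := hH hg
  simpa [Metric.mem_ball, dist_eq_norm] using hball

/-- **local constancy**: a continuous character `χ : A →* ℂ` of a compact totally disconnected group is locally
constant (constant on the open cosets of the subgroup of `exists_openNormalSubgroup_eq_one`). -/
theorem isLocallyConstant_of_continuous [IsTopologicalGroup A] [CompactSpace A]
    [TotallyDisconnectedSpace A] (χ : A →* ℂ) (hχ : Continuous χ) :
    IsLocallyConstant (χ : A → ℂ) := by
  obtain ⟨H, hH⟩ := exists_openNormalSubgroup_eq_one χ hχ
  rw [IsLocallyConstant.iff_exists_open]
  intro x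
  refine ⟨(fun y => x⁻¹ * y) ⁻¹' (H : Set A), ?_, ?_, ?_⟩
  · exact H.isOpen.preimage (continuous_const.mul continuous_id)
  · simp
  · intro y hy
    have h1 : χ (x⁻¹ * y) = 1 := hH _ hy
    calc χ y = χ (x * (x⁻¹ * y)) := by rw [mul_inv_cancel_left]
      _ = χ x * χ (x⁻¹ * y) := map_mul χ _ _
      _ = χ x := by rw [h1, mul_one]

end Characters

/-! ## §4 The model's groups are totally disconnected over an ultrametric field -/

section TotallyDisconnected

/-- the units of a totally disconnected topological monoid form a totally disconnected space (they embed into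
`M × Mᵐᵒᵖ`). -/
theorem totallyDisconnectedSpace_units (M : Type*) [Monoid M] [TopologicalSpace M]
    [TotallyDisconnectedSpace M] : TotallyDisconnectedSpace Mˣ := by
  haveI : TotallyDisconnectedSpace Mᵐᵒᵖ := MulOpposite.opHomeomorph.totallyDisconnectedSpace
  exact (Units.isEmbedding_embedProduct (M := M)).isTotallyDisconnected_range.1
    (isTotallyDisconnected_of_totallyDisconnectedSpace _)

/-- an ultrametric normed field is totally disconnected (Mathlib's instance, named for the record). -/
theorem totallyDisconnectedSpace_of_isUltrametricDist (F : Type*) [NormedField F] [IsUltrametricDist F] :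
    TotallyDisconnectedSpace F :=
  inferInstance

/-- `Fin 2 → Fˣ` is totally disconnected over an ultrametric normed field. -/
theorem totallyDisconnectedSpace_piUnits (F : Type*) [NormedField F] [IsUltrametricDist F] :
    TotallyDisconnectedSpace (Fin 2 → Fˣ) := by
  haveI := totallyDisconnectedSpace_units F
  infer_instance

/-- `GL (Fin 2) F = (Matrix (Fin 2) (Fin 2) F)ˣ` is totally disconnected over an ultrametric normed field. -/
theorem totallyDisconnectedSpace_GL (F : Type*) [NormedField F] [IsUltrametricDist F] :
    TotallyDisconnectedSpace (GL (Fin 2) F) := by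
  haveI : TotallyDisconnectedSpace (Matrix (Fin 2) (Fin 2) F) :=
    inferInstanceAs (TotallyDisconnectedSpace (Fin 2 → Fin 2 → F))
  exact totallyDisconnectedSpace_units _

/-- every subgroup of a totally disconnected topological group is totally disconnected (as a subtype). -/
theorem totallyDisconnectedSpace_subgroup {G : Type*} [Group G] [TopologicalSpace G]
    [TotallyDisconnectedSpace G] (H : Subgroup G) : TotallyDisconnectedSpace H :=
  inferInstance

end TotallyDisconnected

/-! ## §5 The consumer: the concrete tori of TorusSupport / TorusCompact -/

section Consumer

open MeasureTheory Matrix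
  Summit.Ventures.HodgeRepro2.Tier7.Line3.LevelInvariantOrbital
  Summit.Ventures.HodgeRepro2.Tier7.Line3.CongruenceSubgroup
  Summit.Ventures.HodgeRepro2.Tier7.Line3.TorusSupport
  Summit.Ventures.HodgeRepro2.Tier7.Line3.TorusCompact
  Summit.Ventures.HodgeRepro2.Tier7.Line3.LevelTowerTopology
  Summit.Ventures.HodgeRepro2.Tier7.Line3.LevelFactor
  Summit.Ventures.HodgeRepro2.Tier7.Line3.ConcreteLevelFactor

variable {F : Type*} [NormedField F] (σ : F →+* F)

/-- the first torus is totally disconnected over an ultrametric field. -/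
theorem totallyDisconnectedSpace_torusA [IsUltrametricDist F] : TotallyDisconnectedSpace (torusA σ) := by
  haveI := totallyDisconnectedSpace_piUnits F
  exact totallyDisconnectedSpace_subgroup _

/-- the second torus is totally disconnected over an ultrametric field. -/
theorem totallyDisconnectedSpace_torusB [IsUltrametricDist F] (f : Fin 2 → Fin 2 → F) :
    TotallyDisconnectedSpace (torusB σ f) := by
  haveI := totallyDisconnectedSpace_GL F
  exact totallyDisconnectedSpace_subgroup _

/-- **`hχA` discharged**: a continuous character of the first torus is unitary. -/
theorem norm_apply_eq_one_torusA [ProperSpace F] (hσc : Continuous σ) (hσn : ∀ x, ‖σ x‖ = ‖x‖)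
    (χA : torusA σ →* ℂ) (hχ : Continuous χA) (a : torusA σ) : ‖χA a‖ = 1 := by
  haveI := compactSpace_torusA σ hσc hσn
  exact norm_apply_eq_one_of_compact χA hχ a

/-- **`hψB` discharged**: a continuous character of the second torus is unitary. -/
theorem norm_apply_eq_one_torusB [ProperSpace F] (hσc : Continuous σ) (hσn : ∀ x, ‖σ x‖ = ‖x‖)
    (f : Fin 2 → Fin 2 → F) (P : GL (Fin 2) F) (hP : ∀ j, (P : Matrix (Fin 2) (Fin 2) F).col j = f j)
    (ψB : torusB σ f →* ℂ) (hψ : Continuous ψB) (b : torusB σ f) : ‖ψB b‖ = 1 := by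
  haveI := compactSpace_torusB σ f P hσc hσn hP
  exact norm_apply_eq_one_of_compact ψB hψ b

/-- **`hχA'` discharged**: a continuous character of the first torus is locally constant. -/
theorem isLocallyConstant_torusA [ProperSpace F] [IsUltrametricDist F] (hσc : Continuous σ)
    (hσn : ∀ x, ‖σ x‖ = ‖x‖) (χA : torusA σ →* ℂ) (hχ : Continuous χA) :
    IsLocallyConstant (χA : torusA σ → ℂ) := by
  haveI := compactSpace_torusA σ hσc hσn
  haveI := totallyDisconnectedSpace_torusA σ
  exact isLocallyConstant_of_continuous χA hχ

/-- **`hψB'` discharged**: a continuous character of the second torus is locally constant. -/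
theorem isLocallyConstant_torusB [ProperSpace F] [IsUltrametricDist F] (hσc : Continuous σ)
    (hσn : ∀ x, ‖σ x‖ = ‖x‖) (f : Fin 2 → Fin 2 → F) (P : GL (Fin 2) F)
    (hP : ∀ j, (P : Matrix (Fin 2) (Fin 2) F).col j = f j) (ψB : torusB σ f →* ℂ) (hψ : Continuous ψB) :
    IsLocallyConstant (ψB : torusB σ f → ℂ) := by
  haveI := compactSpace_torusB σ f P hσc hσn hP
  haveI := totallyDisconnectedSpace_torusB σ f
  exact isLocallyConstant_of_continuous ψB hψ

/-- **the assembly with CONTINUOUS characters**: ConcreteLevelFactor's `concrete_kappaData_b_fields` binder for binder,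
with the four displayed hypotheses `hχA hψB hχA' hψB'` replaced by `Continuous χA`, `Continuous ψB`. -/
theorem concrete_kappaData_b_fields_of_continuous [ProperSpace F] [IsUltrametricDist F]
    (hσc : Continuous σ) (hσn : ∀ x, ‖σ x‖ = ‖x‖)
    (f : Fin 2 → Fin 2 → F) (P : GL (Fin 2) F) (hP : ∀ j, (P : Matrix (Fin 2) (Fin 2) F).col j = f j)
    {q : ℝ} (hq : 1 < q)
    (hB : ∀ b : torusB σ f, EntryLE normAbv 1 ((iotaB σ f b : GL (Fin 2) F) : Matrix (Fin 2) (Fin 2) F))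
    (hB' : ∀ b : torusB σ f, EntryLE normAbv 1 (((iotaB σ f b)⁻¹ : GL (Fin 2) F) : Matrix (Fin 2) (Fin 2) F))
    {Orb : Type*} (χA : torusA σ →* ℂ) (ψB : torusB σ f →* ℂ) (hχc : Continuous χA) (hψc : Continuous ψB)
    (loc : Orb → GL (Fin 2) F) (γ₀ : Orb)
    (hmatch : ∀ a b, (iotaA σ a)⁻¹ * loc γ₀ * iotaB σ f b = loc γ₀ → χA a * ψB b = 1)
    (arithS : Orb → Prop) (bS : Orb → ℂ) (bS_support : ∀ γ, bS γ ≠ 0 → arithS γ) (C : ℝ) (size : Orb → ℝ)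
    (ε : ℝ) (bS_bound : ∀ γ, arithS γ → ‖bS γ‖ ≤ C * (1 + size γ) ^ ε * ‖bS γ₀‖) (bS_γ₀ : bS γ₀ ≠ 0) :
    ∃ (mA : MeasurableSpace (torusA σ)) (mB : MeasurableSpace (torusB σ f))
      (μA : Measure (torusA σ)) (μB : Measure (torusB σ f))
      (D : LevelFactorData (torusA σ) (torusB σ f) (GL (Fin 2) F) Orb μA μB),
      (@BorelSpace (torusA σ) _ mA) ∧ (@BorelSpace (torusB σ f) _ mB) ∧
      μA.IsHaarMeasure ∧ μB.IsHaarMeasure ∧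
      D.ιA = iotaA σ ∧ D.ιB = iotaB σ f ∧ D.K = levelTower normAbv isNonarchimedean_normAbv hq ∧
      D.loc = loc ∧ D.γ₀ = γ₀ ∧ D.arithS = arithS ∧ D.bS = bS ∧ D.size = size ∧ D.ε = ε ∧
      (∀ N γ, D.b N γ ≠ 0 → D.arith N γ) ∧
      (∃ Bb : ℝ, ∀ N γ, D.arith N γ → ‖D.b N γ‖ ≤ Bb * (1 + D.size γ) ^ D.ε * ‖D.b N D.γ₀‖) ∧
      (∃ N₀ : ℕ, ∀ N ≥ N₀, D.b N D.γ₀ ≠ 0) :=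
  concrete_kappaData_b_fields σ hσc hσn f P hP hq hB hB' χA ψB
    (norm_apply_eq_one_torusA σ hσc hσn χA hχc) (norm_apply_eq_one_torusB σ hσc hσn f P hP ψB hψc)
    (isLocallyConstant_torusA σ hσc hσn χA hχc) (isLocallyConstant_torusB σ hσc hσn f P hP ψB hψc)
    loc γ₀ hmatch arithS bS bS_support C size ε bS_bound bS_γ₀

end Consumer

end Summit.Ventures.HodgeRepro2.Tier7.Line3.CharacterLocallyConstant
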